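import Summits.AtomisticToContinuum.HydrodynamicLimit.Theorems.RelayRaceLocalityConeLocalisationStubTransferConj
import HarnessLib

/-!
# Crux `ConeLocalisation` (stmt-AtomisticToContinuum-12504) — line `einstein-elevator` (sketch `EinsteinElevatorSketch`), skeleton v2 (lead a1, 2026-08-17)

Route `RelayRaceLocality`; crux decl `Summit.AtomisticToContinuum.HydrodynamicLimit.Theses.RelayRaceLocality.ConeLocalisation`
`= LightConeInLaw → NearConstantShortTimeHL → S` (`S = Theorems.ConeLocalisation.ShortTimeGuardedHL`, the short-time
guarded hydrodynamic limit, NO density floor).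

STATE (end of lead a1's cycle 1). Skeleton v1 had five stubs; FOUR are tree theorems:
`Elevator.stub_logSlope` (p147742; order-1 dynamic log-Lipschitz rigidity `|∂ log ρ| ≤ C Mᵃ/t`, floor-free, Lagrangian
both-ends argument), `Elevator.stub_logCurvature` (p152481; order 2), `Elevator.stub_straightness` (p153189; steep ⇒ straight at
the cone scale), `Elevator.stub_transfer` (p144518; `ElevatorOrbitHL → DynamicNearAtmosphere → S`). The fifth, the FOREIGN input
`ElevatorOrbitHL` (near-equilibrium hydrodynamic limit around the elevator orbit {constants} ∪ {free-falling isothermal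
atmospheres}, hyperbolic-scaling covariant, general families), was audited (not a proving task below summit level; no tree
fact implies or refutes it) and RESHAPED to its conjunct-family restriction `ElevatorOrbitHLConj` (p153712), which is all the
transfer consumes (`Elevator.stub_transfer_conj`, …StubTransferConj.lean) and which is a NECESSARY condition of the summit
conjunct (`Elevator.elevatorOrbitHLConj_of_hydrodynamicLimit : HydrodynamicLimit → ElevatorOrbitHLConj`, p153712) — so, like
`S` itself, it cannot be refuted below summit level. THE LINE'S CERTIFICATE (tree theorem):
`Elevator.coneLocalisation_of_elevatorOrbitHLConj : ElevatorOrbitHLConj → ConeLocalisation` — the crux AS TYPED follows from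
the single foreign near-equilibrium input; its two antecedents are unused.

Stubs: closed `stub_logSlope`, `stub_logCurvature`, `stub_straightness`, `stub_transfer_conj` (discharged below by name) /
open `stub_elevatorOrbitHLConj : ElevatorOrbitHLConj` — FOREIGN (calibre of stmt-AtomisticToContinuum-12502), handed back:
`promote-stub`. Composition:
`coneLocalisation_of : ConeLocalisation := fun _ _ => stub_transfer_conj stub_elevatorOrbitHLConj (stub_straightness stub_logSlope (stub_logCurvature stub_logSlope))`.
See `Cruxes/ConeLocalisation/PICKED.md`, `Cruxes/ConeLocalisation/NOTES.md` §a1.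
-/

noncomputable section

open Literature.MathematicalPhysics.KineticTheory Literature.Analysis.FluidPDE
open Literature.Analysis.FunctionSpaces MeasureTheory Filter Set Topology
open Summit.AtomisticToContinuum.HydrodynamicLimit.Theses.RelayRaceLocality
open Summit.AtomisticToContinuum.HydrodynamicLimit.Theorems.ConeLocalisation
open Summit.AtomisticToContinuum.HydrodynamicLimit.Theorems.ConeLocalisation.Elevator

namespace Summit.AtomisticToContinuum.HydrodynamicLimit.Cruxes.ConeLocalisation.EinsteinElevator

/-! ## Closed stubs (tree theorems, discharged by name) -/

/-- STUB 1 (CLOSED, p147742): order-1 dynamic log-Lipschitz rigidity of the guard class. -/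
theorem stub_logSlope : DynamicLogSlopeBound :=
  Summit.AtomisticToContinuum.HydrodynamicLimit.Theorems.ConeLocalisation.Elevator.stub_logSlope

/-- STUB 2 (CLOSED, p152481): order-2 dynamic log-Lipschitz rigidity of the guard class. -/
theorem stub_logCurvature : DynamicLogSlopeBound → DynamicLogCurvatureBound :=
  Summit.AtomisticToContinuum.HydrodynamicLimit.Theorems.ConeLocalisation.Elevator.stub_logCurvature

/-- STUB 3 (CLOSED, p153189): steep ⇒ straight at the cone scale. -/
theorem stub_straightness : DynamicLogSlopeBound → DynamicLogCurvatureBound → DynamicNearAtmosphere :=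
  Summit.AtomisticToContinuum.HydrodynamicLimit.Theorems.ConeLocalisation.Elevator.stub_straightness

/-- STUB 5 (CLOSED, …StubTransferConj.lean): the transfer from the conjunct-family foreign input to `S` as typed. -/
theorem stub_transfer_conj : ElevatorOrbitHLConj → DynamicNearAtmosphere → ShortTimeGuardedHL :=
  Summit.AtomisticToContinuum.HydrodynamicLimit.Theorems.ConeLocalisation.Elevator.stub_transfer_conj

/-! ## The open stub (FOREIGN) -/

/-- STUB 4 (FOREIGN INPUT of the line; calibre of `NearConstantShortTimeHL`, stmt-AtomisticToContinuum-12502; a necessary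
condition of the summit conjunct, `elevatorOrbitHLConj_of_hydrodynamicLimit`; not derivable from the route's antecedents;
handed back to the planner): `ElevatorOrbitHLConj`. -/
theorem stub_elevatorOrbitHLConj : ElevatorOrbitHLConj := by
  sorry

/-! ## The composition -/

/-- COMPOSITION: the crux `ConeLocalisation` BY NAME (the two antecedents are unused). -/
theorem coneLocalisation_of : ConeLocalisation :=
  fun _ _ => stub_transfer_conj stub_elevatorOrbitHLConj (stub_straightness stub_logSlope (stub_logCurvature stub_logSlope))

end Summit.AtomisticToContinuum.HydrodynamicLimit.Cruxes.ConeLocalisation.EinsteinElevator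

end
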